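import Literature.IUT.HodgeTheaters.InitialThetaDataPlaces
import Literature.IUT.HodgeTheaters.PMBaseKitModel
import Mathlib.Logic.Small.Basic
import Mathlib.Data.Countable.Small

/-!
# The place-kit bridge `InitialThetaData → PMBaseKit` over ALL of `V̲` (merge canon C9-d, RULING D13 (β) / B11)

Mochizuki, *Inter-universal Teichmüller Theory I*, kurims manuscript (May 2020), Def 3.1 (b), (e)
pp. 61–62, Def 4.1 (i) p. 95, Def 6.1 pp. 155–159 [cite: Mochizuki2012, I Def 3.1 (e) p.62, Def 6.1 p.155]
(D-0012 claim key, status disputed; BRIDGE between two landed typings — nothing of the series is asserted).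

With the unused field `PMBaseKit.fintypeV` deleted (bridge debt B11 of plan/L6/MERGE-MAP.md §8; the
superseding revision of `PMBaseKit.lean`), abc-iut-L5-t4's [IUTchI] §5–§6 kit can be indexed by print's
INFINITE `V̲` ([IUTchI] Def 3.1 (e): "`V̲ ⊆ V(K)` is a subset that induces a natural bijection `V̲ ⥲ V_mod`";
abc-iut-L5-t2's `InitialThetaData.V`, `isEmpty_fintype_V`). This file types the un-truncated bridge of
record (RULING D13 (β); L5-lead 2026-08-25 22:11:48Z / 23:35:38Z (4)), in the shape of the truncated one
(`InitialThetaData.TruncatedKit`, abc-iut-L6-t7): a HYPOTHESIS STRUCTURE `InitialThetaData.PlaceKit D` = a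
kit `PMBaseKit l` WHOSE INDEX SET IS `V̲` (an `Equiv` carrying `bad ↦ V̲^bad`, `arc ↦ V̲^arc`; the kit proper —
tempered / étale fundamental groups, Aut-holomorphic orbispaces — is the L3/L4/L5 merge and is not
constructed here) and — KIT-RULE non-vacuity — an inhabitant over abc-iut-L5-t4's toy kit indexed by a `Type 0`
copy of the countable set `V̲` (`Val.countable`, `PMBaseKit.reindex'`, `PlaceKit.toy`). With it the RECORDED
WEAKENING of the truncated bridge ("truncation to finite `S`") disappears for every decl that does not sum over
all of `V̲` (MERGE-MAP §4 D13). The comparison with the truncated family (`PlaceKit ↦ TruncatedKit D S` for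
every finite `S`, restriction laws) is a separate sibling file over `TruncatedPlaceKitBridge`.
-/

namespace Literature.IUT.HodgeTheaters

open CategoryTheory

universe uK u v w

namespace PMBaseKit

variable {l : ℕ}

/-- **IUTchI:Def6.1** (kurims p.156) **Re-indexing a base kit by an arbitrary index type** — the form of
abc-iut-L6-t7's `PMBaseKit.reindex` without the finiteness binder, available once the unused field
`PMBaseKit.fintypeV` is deleted (bridge debt B11): every per-valuation field of the kit is a datum AT `v` and the
global fields do not mention `V`, so a kit indexed by `V` and any map `f : W → V` give a kit indexed by `W`, with
freely prescribed finite sets `W^bad`, `W^arc`. Used to index the toy kit by (a copy of) the infinite `V̲`.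
[claim: Mochizuki2012, status: disputed] -/
def reindex' (K : PMBaseKit.{uK} l) (W : Type) [DecidableEq W] (f : W → K.V)
    (bad arc : Finset W) : PMBaseKit.{uK} l where
  V := W
  bad := bad
  arc := arc
  Amb w := K.Amb (f w)
  model w := K.model (f w)
  pmObj w := K.pmObj (f w)
  toPM w := K.toPM (f w)
  LabCuspPM w := K.LabCuspPM (f w)
  labPM w := K.labPM (f w)
  labMap w := K.labMap (f w)
  labMap_refl w := K.labMap_refl (f w)
  labMap_trans w := K.labMap_trans (f w)
  labMap_charts w := K.labMap_charts (f w)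
  exists_negative w := K.exists_negative (f w)
  Glob := K.Glob
  gModel := K.gModel
  gIso := K.gIso
  GLab := K.GLab
  gLabMap := K.gLabMap
  gLabMap_refl := K.gLabMap_refl
  gLabMap_trans := K.gLabMap_trans
  toFlStar := K.toFlStar
  toFlStar_surjective := K.toFlStar_surjective
  gLabT := K.gLabT
  gChart₀ := K.gChart₀
  gChart₀_mem := K.gChart₀_mem
  autCsp_le := K.autCsp_le
  gLab_range := K.gLab_range
  atV w := K.atV (f w)
  phiEll w := K.phiEll (f w)
  labOfHom w := K.labOfHom (f w)
  labOfHom_pre w := K.labOfHom_pre (f w)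
  labOfHom_post w := K.labOfHom_post (f w)
  labOfHom_phiEll_bijective w := K.labOfHom_phiEll_bijective (f w)
  labOfHom_phiEll_charts w := K.labOfHom_phiEll_charts (f w)

/-- **IUTchI:Def6.1** (kurims p.156) The ambient category of the re-indexed kit at `w` IS that of the kit at `f w`.
[claim: Mochizuki2012, status: disputed] -/
theorem reindex'_Amb (K : PMBaseKit.{uK} l) (W : Type) [DecidableEq W] (f : W → K.V) (bad arc : Finset W)
    (w : W) : (K.reindex' W f bad arc).Amb w = K.Amb (f w) := rfl

end PMBaseKit

/-! ### Countability of the places of a number field (for a `Type 0` index copy of `V̲`) -/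

section Countable

variable (F : Type u) [Field F] [NumberField F]

/-- A number field has countably many ideals of integers: every ideal of the Noetherian ring `𝓞 F` is
generated by a finite subset, and `𝓞 F` (a free `ℤ`-module of finite rank) is countable. [folklore] -/
private theorem NumberField.countable_ideal_ringOfIntegers : Countable (Ideal (NumberField.RingOfIntegers F)) := by
  haveI : Countable F := Countable.of_equiv _ (Module.finBasis ℚ F).equivFun.toEquiv.symm
  haveI : Countable (NumberField.RingOfIntegers F) := Subtype.countable
  have h : ∀ I : Ideal (NumberField.RingOfIntegers F), ∃ s : Finset (NumberField.RingOfIntegers F),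
      Ideal.span (s : Set _) = I := fun I => IsNoetherian.noetherian I
  choose gen hgen using h
  have hinj : Function.Injective gen := fun I J hIJ => by rw [← hgen I, ← hgen J, hIJ]
  exact hinj.countable

/-- A number field has countably many places (`Val F = V(F)^arc ⊔ V(F)^non`, [IUTchI] §0 "Numbers" p. 35):
finitely many archimedean ones and countably many finite ones (a finite place is determined by its
maximal ideal). [folklore] -/
private theorem Val.countable : Countable (Val F) := by
  haveI := NumberField.countable_ideal_ringOfIntegers F
  haveI : Countable (IsDedekindDomain.HeightOneSpectrum (NumberField.RingOfIntegers F)) :=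
    Function.Injective.countable
      (f := fun v : IsDedekindDomain.HeightOneSpectrum (NumberField.RingOfIntegers F) => v.asIdeal)
      fun _ _ h => IsDedekindDomain.HeightOneSpectrum.ext h
  haveI : Countable (NumberField.FinitePlace F) :=
    Function.Injective.countable (NumberField.FinitePlace.maximalIdeal_injective (K := F))
  unfold Val
  infer_instance

end Countable

section Places

variable {F : Type u} {K : Type v} {Fbar : Type w} [Field F] [NumberField F] [Field K]
  [NumberField K] [Algebra F K] [Field Fbar] [Algebra F Fbar] [Algebra K Fbar]
  {E : WeierstrassCurve F} [E.IsElliptic] {l : ℕ} {P : BadPlacePredicates K}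
  (D : InitialThetaData F K Fbar E l P)

namespace InitialThetaData

/-- **IUTchI:Def6.1** (kurims p.156) **The place-kit bridge over all of `V̲`** (RULING D13 (β)): a `PlaceKit D`
is abc-iut-L5-t4's [IUTchI] §6 base kit `PMBaseKit l` WHOSE INDEX SET IS `V̲` ([IUTchI] Def 3.1 (e) p. 62): an
identification `kit.V ≃ V̲` under which `kit.bad` is `V̲^bad` and `kit.arc` is `V̲^arc`. HYPOTHESIS STRUCTURE
(the real kit — `ℬ^temp(X_v)⁰`, `ℬ(X→_v)⁰`, the Aut-holomorphic orbispaces, [IUTchI] Examples 3.2–3.4 /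
Def 4.1 (i) / 6.1 (ii) — is the L3/L4/L5 merge, not built here); every L5/L6/c312 decl over a `PMBaseKit`
specialises along `T.kit` to "the initial Θ-data `D`", with no truncation. [claim: Mochizuki2012, status: disputed] -/
structure PlaceKit : Type (max uK v + 1) where
  /-- the kit ([IUTchI] Def 6.1 interface of abc-iut-L5-t4) -/
  kit : PMBaseKit.{uK} l
  /-- its index set IS `V̲` -/
  e : kit.V ≃ ↥D.V
  /-- `kit.bad` corresponds to `V̲^bad` ([IUTchI] Def 3.1 (e), via the bad places of (b)) -/
  mem_bad_iff : ∀ x : kit.V, x ∈ kit.bad ↔ ((e x : Val K) ∈ D.Vbad)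
  /-- `kit.arc` corresponds to `V̲^arc` -/
  mem_arc_iff : ∀ x : kit.V, x ∈ kit.arc ↔ ((e x : Val K) ∈ D.Varc)

namespace PlaceKit

variable {D}

/-- **IUTchI:Def3.1(e)** (kurims p.62) The valuation `v̲ ∈ V̲ ⊆ V(K)` indexed by an element of a place kit.
[claim: Mochizuki2012, status: disputed] -/
def val (T : D.PlaceKit) (x : T.kit.V) : Val K := (T.e x : Val K)

/-- **IUTchI:Def3.1(e)** (kurims p.62) Indices of a place kit are valuations in `V̲`. [claim: Mochizuki2012, status: disputed] -/
theorem val_mem_V (T : D.PlaceKit) (x : T.kit.V) : T.val x ∈ D.V := (T.e x).2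

/-- **IUTchI:Def3.1(e)** (kurims p.62) `val` is injective (the index set is `V̲` itself). [claim: Mochizuki2012, status: disputed] -/
theorem val_injective (T : D.PlaceKit) : Function.Injective T.val :=
  fun _ _ h => T.e.injective (Subtype.ext h)

/-- **IUTchI:Def3.1(e)** (kurims p.62) Every valuation of `V̲` is indexed (no truncation). [claim: Mochizuki2012, status: disputed] -/
theorem range_val (T : D.PlaceKit) : Set.range T.val = D.V := by
  ext w
  constructor
  · rintro ⟨x, rfl⟩; exact T.val_mem_V x
  · intro hw
    obtain ⟨x, hx⟩ := T.e.surjective ⟨w, hw⟩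
    exact ⟨x, by change ((T.e x : D.V) : Val K) = w; rw [hx]⟩

/-- **IUTchI:Def3.1(e)** (kurims p.62) The kit's bad indices are exactly `V̲^bad`. [claim: Mochizuki2012, status: disputed] -/
theorem val_image_bad (T : D.PlaceKit) : T.val '' (T.kit.bad : Set T.kit.V) = D.Vbad := by
  ext w
  constructor
  · rintro ⟨x, hx, rfl⟩
    exact (T.mem_bad_iff x).1 hx
  · intro hw
    obtain ⟨y, hy⟩ := T.e.surjective ⟨w, hw.1⟩
    refine ⟨y, (T.mem_bad_iff y).2 ?_, ?_⟩
    · rw [hy]; exact hw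
    · change ((T.e y : D.V) : Val K) = w
      rw [hy]

/-- **IUTchI:Def3.1(e)** (kurims p.62) The kit's archimedean indices are exactly `V̲^arc`. [claim: Mochizuki2012, status: disputed] -/
theorem val_image_arc (T : D.PlaceKit) : T.val '' (T.kit.arc : Set T.kit.V) = D.Varc := by
  ext w
  constructor
  · rintro ⟨x, hx, rfl⟩
    exact (T.mem_arc_iff x).1 hx
  · intro hw
    obtain ⟨y, hy⟩ := T.e.surjective ⟨w, hw.1⟩
    refine ⟨y, (T.mem_arc_iff y).2 ?_, ?_⟩
    · rw [hy]; exact hw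
    · change ((T.e y : D.V) : Val K) = w
      rw [hy]

/-- **IUTchI:Def3.1(b)** (kurims p.61) The kit has a bad index ("`V^bad_mod` … nonempty").
[claim: Mochizuki2012, status: disputed] -/
theorem bad_nonempty (T : D.PlaceKit) : T.kit.bad.Nonempty := by
  obtain ⟨w, hw⟩ := D.Vbad_nonempty
  rw [← T.val_image_bad] at hw
  obtain ⟨x, hx, -⟩ := hw
  exact ⟨x, hx⟩

end PlaceKit

/-! ### Towards non-vacuity: a `Type 0` copy of `V̲` and its bad / archimedean index sets -/

/-- **IUTchI:Def3.1(e)** (kurims p.62) `V̲^arc` is finite: the archimedean valuations of `K` are finitely many.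
[claim: Mochizuki2012, status: disputed] -/
theorem Varc_finite : D.Varc.Finite := by
  refine (Set.finite_range (Sum.inl : NumberField.InfinitePlace K → Val K)).subset ?_
  rintro w ⟨-, hw⟩
  rcases w with w | w
  · exact ⟨w, rfl⟩
  · exact absurd hw (by simp [Val.IsArc])

/-- **IUTchI:Def3.1(e)** (kurims p.62) `V̲` is countable (valuations of the number field `K`), hence has a copy
in `Type 0` (`Shrink`), the universe of `PMBaseKit.V` (a theorem, not an instance). [claim: Mochizuki2012, status: disputed] -/
theorem small_V : Small.{0} ↥D.V := by
  haveI : Countable (Val K) := Val.countable K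
  infer_instance

/-- **IUTchI:Def3.1(e)** (kurims p.62) The `Type 0` copy of `V̲` used to index the toy place kit.
[claim: Mochizuki2012, status: disputed] -/
def IndexCopy : Type := @Shrink.{0} ↥D.V D.small_V

/-- **IUTchI:Def3.1(e)** (kurims p.62) The identification of the `Type 0` copy with `V̲`. [claim: Mochizuki2012, status: disputed] -/
noncomputable def indexCopyEquiv : D.IndexCopy ≃ ↥D.V := (@equivShrink ↥D.V D.small_V).symm

/-- **IUTchI:Def3.1(e)** (kurims p.62) The valuation of `V̲ ⊆ V(K)` named by an index of the copy. [claim: Mochizuki2012, status: disputed] -/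
noncomputable def indexCopyVal (x : D.IndexCopy) : Val K := (D.indexCopyEquiv x : Val K)

/-- **IUTchI:Def3.1(e)** (kurims p.62) Distinct indices of the copy name distinct valuations. [claim: Mochizuki2012, status: disputed] -/
theorem indexCopyVal_injective : Function.Injective D.indexCopyVal :=
  fun _ _ h => D.indexCopyEquiv.injective (Subtype.ext h)

/-- **IUTchI:Def3.1(e)** (kurims p.62) The bad indices of the copy: those over `V̲^bad` — a `Finset`, `V̲^bad` being finite
(`Vbad_finite`). [claim: Mochizuki2012, status: disputed] -/
noncomputable def indexCopyBad : Finset D.IndexCopy :=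
  (D.Vbad_finite.preimage D.indexCopyVal_injective.injOn).toFinset

/-- **IUTchI:Def3.1(e)** (kurims p.62) The archimedean indices of the copy: those over `V̲^arc` (`Varc_finite`).
[claim: Mochizuki2012, status: disputed] -/
noncomputable def indexCopyArc : Finset D.IndexCopy :=
  (D.Varc_finite.preimage D.indexCopyVal_injective.injOn).toFinset

/-- **IUTchI:Def3.1(e)** (kurims p.62) Membership in the bad index set of the copy. [claim: Mochizuki2012, status: disputed] -/
theorem mem_indexCopyBad_iff (x : D.IndexCopy) :
    x ∈ D.indexCopyBad ↔ D.indexCopyVal x ∈ D.Vbad := by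
  simp [indexCopyBad]

/-- **IUTchI:Def3.1(e)** (kurims p.62) Membership in the archimedean index set of the copy. [claim: Mochizuki2012, status: disputed] -/
theorem mem_indexCopyArc_iff (x : D.IndexCopy) :
    x ∈ D.indexCopyArc ↔ D.indexCopyVal x ∈ D.Varc := by
  simp [indexCopyArc]


open scoped Classical in
/-- **IUTchI:Def6.1** (kurims p.156) **Non-vacuity of the place-kit bridge.** For EVERY initial Θ-data `D`, the toy kit of
abc-iut-L5-t4 (`PMBaseKit.toyKit`, one valuation) re-indexed by the `Type 0` copy of the INFINITE `V̲` with
`bad := ` the indices over `V̲^bad`, `arc := ` those over `V̲^arc` is a place kit: the hypothesis structure is inhabited (so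
decls over it are not vacuously true), without any claim that this inhabitant is print's kit.
[claim: Mochizuki2012, status: disputed] -/
noncomputable def PlaceKit.toy (D : InitialThetaData F K Fbar E l P) : PlaceKit.{0} D :=
  haveI : Fact l.Prime := ⟨D.l_prime⟩
  have hl : l ≠ 2 := by have := D.five_le_l; omega
  { kit := (PMBaseKit.toyKit l hl).reindex' D.IndexCopy (fun _ => ()) D.indexCopyBad D.indexCopyArc
    e := D.indexCopyEquiv
    mem_bad_iff := D.mem_indexCopyBad_iff
    mem_arc_iff := D.mem_indexCopyArc_iff }

/-- **IUTchI:Def3.1(e)** (kurims p.62) The toy place kit's index-to-valuation map is the identification of the copy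
with `V̲`. [claim: Mochizuki2012, status: disputed] -/
theorem PlaceKit.toy_val (D : InitialThetaData F K Fbar E l P) (x : (PlaceKit.toy D).kit.V) :
    (PlaceKit.toy D).val x = D.indexCopyVal x := rfl

end InitialThetaData

end Places

end Literature.IUT.HodgeTheaters
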